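import Summits.BirchSwinnertonDyer.Rank1Residual.Supersingular.CountPointsFast
import HarnessLib

/-!
# `countPointsFast` in SPLIT form — two partial column sums decided separately (kernel recursion budget; TOOL)

Cell `b2b-bsdres`, supersingular family, prover B = unit `b2b-bsdres-additive-p3` (gen 23). Topic file; namespace
`Summit.BirchSwinnertonDyer.Rank1Residual.Supersingular`. ONE theorem, no definition, no named fact, nothing booked.

HONEST FRAMING (run/shared/lean/b2b/bsd-rank1-residual/, verbatim): the goal of the cell is to DELETE the
COMBINATION-SHAPED residual classes of the BSD formula in analytic rank `≤ 1` from PUBLISHED theorems only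
and to TYPE the construction-shaped ones; this is not "finishing BSD".

## Why

Prover A's `countPointsFast [a₁,…,a₆] ℓ` (`CountPointsFast.lean`, p308351) is `1 + ∑_{x < ℓ} (1 + (disc(x) | ℓ))` over
`List.range ℓ` with Euler's criterion by binary exponentiation; `decide +kernel` evaluates it at `ℓ = 13 177` (B's
level-27 record for 323219e1) but fails between there and `ℓ = 18 199` with "maximum recursion depth has been
reached" — the kernel unfolds the `ℓ`-element `List.sum` recursively. iw-2's ENGINE K depth-3 levels reach
`ℓ = 18 523` (307520bh1), `18 199` (389104b1), `25 111`. Splitting `List.range ℓ = List.range' 0 k ++ List.range' k (ℓ − k)`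
lets a record decide the two half sums (each `< 13 000` terms) separately and add them by `norm_num`.

## What

`countPointsFast_eq_of_split a₁ … a₆ ℓ k (hk : k ≤ ℓ) (h₁ : ∑_{x<k} … = s₁) (h₂ : ∑_{k≤x<ℓ} … = s₂) (hn : 1 + (s₁ + s₂) = n) :
countPointsFast [a₁,…,a₆] ℓ = n` — then `countPoints_eq_of_fast` / `natCard_point_eq_of_countPoints` as before.

References: [IrelandRosen1990] Prop. 5.1.2 (Euler's criterion); [SilvermanAEC2009] V.1.
-/

namespace Summit.BirchSwinnertonDyer.Rank1Residual.Supersingular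

/-- **Split form of the fast count** (kernel budget): `countPointsFast [a₁,…,a₆] ℓ = n` from the two partial
column sums over `x < k` and `k ≤ x < ℓ` (the summand is `countPointsFast`'s, written out), each decided
separately, and `1 + (s₁ + s₂) = n`. The one-piece `decide +kernel` evaluation of the `ℓ`-term sum exceeds the
kernel's recursion depth between `ℓ = 13 177` (passes) and `ℓ = 18 199` (fails). [folklore] -/
theorem countPointsFast_eq_of_split (a1 a2 a3 a4 a6 : ℤ) (ℓ k : ℕ) (hk : k ≤ ℓ) {s₁ s₂ n : ℤ}
    (h₁ : ((List.range' 0 k).map fun (x : ℕ) =>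
      1 + legendreSymFast ((a1 * x + a3) * (a1 * x + a3) + 4 * ((x : ℤ) * x * x + a2 * x * x + a4 * x + a6)) ℓ).sum
        = s₁)
    (h₂ : ((List.range' k (ℓ - k)).map fun (x : ℕ) =>
      1 + legendreSymFast ((a1 * x + a3) * (a1 * x + a3) + 4 * ((x : ℤ) * x * x + a2 * x * x + a4 * x + a6)) ℓ).sum
        = s₂)
    (hn : 1 + (s₁ + s₂) = n) :
    countPointsFast [a1, a2, a3, a4, a6] ℓ = n := by
  have hsplit : List.range ℓ = List.range' 0 k ++ List.range' k (ℓ - k) := by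
    rw [List.range_eq_range', show ℓ = k + (ℓ - k) from (Nat.add_sub_cancel' hk).symm, ← List.range'_append]
    simp [Nat.add_sub_cancel' hk]
  unfold countPointsFast
  simp only
  rw [hsplit, List.map_append, List.sum_append, h₁, h₂, hn]

/-- Regression (389104b1, engine-K level `ℓ = 18 199`, `#Ẽ(𝔽_ℓ) = 18 252 = ℓ + 1 − (−52)`): the split at `k = 9000`
(`9005 + 9246 + 1`). [folklore] -/
theorem countPointsFast_split_test_389104b1_18199 :
    countPointsFast [0, 0, 0, -70, -561] 18199 = ((18252 : ℕ) : ℤ) :=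
  countPointsFast_eq_of_split 0 0 0 (-70) (-561) 18199 9000 (by norm_num) (s₁ := 9005) (s₂ := 9246)
    (by decide +kernel) (by decide +kernel) (by norm_num)

/-! ### APPEND (additive-p3 GEN 23, same day): THREE chunks — engine-K depth-3 Kolyvagin primes reach `ℓ = 34 129`
(197200be1), beyond two chunks of `≤ 13 177` -/

/-- **Three-chunk split of the fast count**: `countPointsFast [a₁,…,a₆] ℓ = n` from the partial column sums over
`x < k₁`, `k₁ ≤ x < k₂`, `k₂ ≤ x < ℓ`, each decided separately, and `1 + (s₁ + (s₂ + s₃)) = n` (covers `ℓ` up to about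
`39 000` with chunks of `13 000`). [folklore] -/
theorem countPointsFast_eq_of_split3 (a1 a2 a3 a4 a6 : ℤ) (ℓ k₁ k₂ : ℕ) (hk₁ : k₁ ≤ k₂) (hk₂ : k₂ ≤ ℓ) {s₁ s₂ s₃ n : ℤ}
    (h₁ : ((List.range' 0 k₁).map fun (x : ℕ) =>
      1 + legendreSymFast ((a1 * x + a3) * (a1 * x + a3) + 4 * ((x : ℤ) * x * x + a2 * x * x + a4 * x + a6)) ℓ).sum
        = s₁)
    (h₂ : ((List.range' k₁ (k₂ - k₁)).map fun (x : ℕ) =>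
      1 + legendreSymFast ((a1 * x + a3) * (a1 * x + a3) + 4 * ((x : ℤ) * x * x + a2 * x * x + a4 * x + a6)) ℓ).sum
        = s₂)
    (h₃ : ((List.range' k₂ (ℓ - k₂)).map fun (x : ℕ) =>
      1 + legendreSymFast ((a1 * x + a3) * (a1 * x + a3) + 4 * ((x : ℤ) * x * x + a2 * x * x + a4 * x + a6)) ℓ).sum
        = s₃)
    (hn : 1 + (s₁ + (s₂ + s₃)) = n) :
    countPointsFast [a1, a2, a3, a4, a6] ℓ = n := by
  refine countPointsFast_eq_of_split a1 a2 a3 a4 a6 ℓ k₁ (hk₁.trans hk₂) h₁ ?_ hn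
  have hsplit : List.range' k₁ (ℓ - k₁) = List.range' k₁ (k₂ - k₁) ++ List.range' k₂ (ℓ - k₂) := by
    rw [show ℓ - k₁ = (k₂ - k₁) + (ℓ - k₂) by omega, ← List.range'_append]
    simp [Nat.add_sub_cancel' hk₁]
  rw [hsplit, List.map_append, List.sum_append, h₂, h₃]

set_option maxHeartbeats 800000 in -- three `decide +kernel` chunk sums at ℓ = 34 129 (default 200000 reached in the probe)
/-- Regression (197200be1, engine-K level `ℓ = 34 129`, `#Ẽ(𝔽_ℓ) = 34 344 = ℓ + 1 − (−214)`): chunks at `12 000` / `24 000`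
(`12302 + 11845 + 10196 + 1`); the three kernel evaluations together exceed the default heartbeat budget at this `ℓ`
(each Euler power is a `17 064`-bit exponentiation), hence the raised limit — records at `ℓ ≳ 18 500` do the same. [folklore] -/
theorem countPointsFast_split3_test_197200be1_34129 :
    countPointsFast [0, 0, 0, 9836125, 817241250] 34129 = ((34344 : ℕ) : ℤ) :=
  countPointsFast_eq_of_split3 0 0 0 9836125 817241250 34129 12000 24000 (by norm_num) (by norm_num)
    (s₁ := 12302) (s₂ := 11845) (s₃ := 10196) (by decide +kernel) (by decide +kernel) (by decide +kernel) (by norm_num)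

end Summit.BirchSwinnertonDyer.Rank1Residual.Supersingular
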